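import Summits.Ventures.PercRepro.Night2NonFatColoop
import Summits.Ventures.PercRepro.Night2NonFatStructure
import Summits.Ventures.PercRepro.Night2NonFatHyperplanes
import Summits.Ventures.PercRepro.Night2NonFatLineCell
import Summits.Ventures.PercRepro.Night2BasisFaces
import Summits.Ventures.PercRepro.Night2OneFatTargets
import Summits.Ventures.PercRepro.Night2FatDegGeom

/-!
# night-2: the NON-FAT case of (FAIR) — the general level-1 bounds (gen 37)

At a level-1 target `T = Q ∪ {y}` of a basis pair (`Q′ = Q ∖ K` a basis of `V`, `y ∈ W = G ∖ Q`):

* the thin covering preimages of `T` are faces `T.erase w` at the coloops `w` of `T ∖ K` (g32); a coloop `w ∈ Q′` of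
  `Q′ ∪ {y}` has `y ∈ cl (Q′ ∖ w)` (else, by exchange, `w ∈ cl ((Q′ ∖ w) ∪ {y})`: `mem_clF_erase_of_mem_coloops_insert`), so
  **`L1_insert_le_sum_support`**: `L1 T ≤ Σ_{w active, y ∈ cl (Q.erase w)} r_w` — the requests of the active faces whose
  hyperplane CONTAINS `y` (the complement of the support `S(y)`), and **`vCap_insert_ge`**: `vCap T ≥ 11/18 − that sum`
  (the target is unloaded and `capS ≥ 11/18`);
* the member faces inside `T` are the faces `Q.erase w` of `Q` itself (weight `phiFace · (1 + [y ∉ cl (Q.erase w)])`,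
  `card_sdiff_clF_erase_eq`) and the faces through `y` (at most ten, `card_facesIn_mem_le_ten`, each of weight `≤ 2/9`):
  **`faceSum_insert_le`**.
Together: the level-1 term of `y` is at least
`(11/18 − Σ_{w active, y ∈ H_w} r_w) / (Σ_{w active} phi_w (1 + [y ∉ H_w]) + (2/9) · #faces through y)` — the input of every
regime proof of the non-fat case beyond the coloop points.
Paper: proofs/NIGHT-2-g37.md §6.
-/

namespace PercRepro.Shadow

open PercRepro.ThmH PercRepro.PerFlat

variable {α : Type*} [DecidableEq α] {M : Matroid α} [M.Finite] {G : Finset α}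

/-! ## The coloops of `Q′ ∪ {y}` -/

/-- `(insert y Q) ∖ K = insert y (Q ∖ K)` for `y ∉ K`. -/
theorem insert_sdiff_coloops_eq {Q : Finset α} {y : α} (hy : y ∉ coloops M G) :
    insert y Q \ coloops M G = insert y (Q \ coloops M G) := by
  ext e
  simp only [Finset.mem_sdiff, Finset.mem_insert]
  constructor
  · rintro ⟨h | h, hK⟩
    · exact Or.inl h
    · exact Or.inr ⟨h, hK⟩
  · rintro (rfl | ⟨h, hK⟩)
    · exact ⟨Or.inl rfl, hy⟩
    · exact ⟨Or.inr h, hK⟩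

/-- **A coloop `w ∈ Q′` of `Q′ ∪ {y}` has `y ∈ cl (Q′ ∖ w)`**: otherwise `(Q′ ∖ w) ∪ {y}` has rank `5` and `w` lies in its
closure (exchange). -/
theorem mem_clF_erase_of_mem_coloops_insert (hG : G ∈ flatsQ M (5 + 1)) (hd : (gr M \ G).card = 2)
    (hk : kColoops M G = 1) {B : Finset α} (hB : B ∈ thinMembers M 5 G) (hnP : ¬ bigP M G B) {z : α}
    (hz : z ∈ G \ clF M B) {y : α} (hy : y ∈ G \ insert z B) {w : α} (hw : w ∈ insert z B \ coloops M G)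
    (hcol : w ∈ coloops M (insert y (insert z B) \ coloops M G)) : y ∈ clF M ((insert z B).erase w) := by
  have hd' : (gr M \ G).card ≤ 5 := by omega
  have hGg : G ⊆ gr M := (mem_flatsQ.1 hG).1
  have hBG : B ⊆ G := subset_G_of_mem_thinMembers hB
  have hQG : insert z B ⊆ G := Finset.insert_subset (Finset.mem_sdiff.1 hz).1 hBG
  have hKB : coloops M G ⊆ B := coloops_subset_of_mem_thinMembers hG hd' hB
  have hyG : y ∈ G := (Finset.mem_sdiff.1 hy).1
  have hyQ : y ∉ insert z B := (Finset.mem_sdiff.1 hy).2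
  have hyK : y ∉ coloops M G := fun h => hyQ (Finset.mem_insert_of_mem (hKB h))
  have hwQ : w ∈ insert z B := (Finset.mem_sdiff.1 hw).1
  have hyw : y ≠ w := fun h => hyQ (h ▸ hwQ)
  by_contra hcl
  -- `Q′ ∖ w` has rank `4` and `y` is off its closure
  have hQ'rk : rkN M (insert z B \ coloops M G) = (insert z B \ coloops M G).card :=
    rkN_eq_card_of_subset_of_rkN_eq_card (rkN_insert_eq_card hG hd hk hB hnP hz) Finset.sdiff_subset
  have hQ'card : (insert z B \ coloops M G).card = 5 := by
    have h4 := card_sdiff_eq_four_of_not_bigP hG hd hk hB hnP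
    have hzB : z ∉ B := fun h => (Finset.mem_sdiff.1 hz).2 (subset_clF_of_subset_gr (hBG.trans hGg) h)
    rw [insert_sdiff_coloops_eq (fun h => hzB (hKB h)), Finset.card_insert_of_notMem
      (fun h => hzB (Finset.mem_sdiff.1 h).1), h4]
  have hwK : w ∉ coloops M G := (Finset.mem_sdiff.1 hw).2
  have herase_sub : (insert z B \ coloops M G).erase w ⊆ (insert z B).erase w :=
    Finset.erase_subset_erase _ Finset.sdiff_subset
  have hcl' : y ∉ clF M ((insert z B \ coloops M G).erase w) := fun h => hcl (clF_mono herase_sub h)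
  have hr4 : rkN M ((insert z B \ coloops M G).erase w) = 4 := by
    rw [rkN_eq_card_of_subset_of_rkN_eq_card hQ'rk (Finset.erase_subset _ _), Finset.card_erase_of_mem hw, hQ'card]
  have hr5 : rkN M (insert y ((insert z B \ coloops M G).erase w)) = 5 := by
    rw [rkN_insert_of_notMem_clF (M := M) (hGg hyG) hcl', hr4]
  -- `(T ∖ K).erase w = insert y ((Q ∖ K).erase w)`
  have hset : (insert y (insert z B) \ coloops M G).erase w = insert y ((insert z B \ coloops M G).erase w) := by
    rw [insert_sdiff_coloops_eq hyK, Finset.erase_insert_of_ne hyw]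
  -- the rank of `V` is `5`, so adding `w` does not raise the rank: `w` is in the closure, not a coloop
  have hV5 := rkN_sdiff_coloops_eq_five hG hk
  have hsub : insert w (insert y ((insert z B \ coloops M G).erase w)) ⊆ G \ coloops M G := by
    apply Finset.insert_subset (Finset.mem_sdiff.2 ⟨hQG hwQ, hwK⟩)
    apply Finset.insert_subset (Finset.mem_sdiff.2 ⟨hyG, hyK⟩)
    exact (Finset.erase_subset _ _).trans (Finset.sdiff_subset_sdiff hQG (le_refl _))
  have hle : rkN M (insert w (insert y ((insert z B \ coloops M G).erase w))) ≤
      rkN M (insert y ((insert z B \ coloops M G).erase w)) := by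
    have := rkN_mono (M := M) hsub
    omega
  have hmem := mem_clF_of_rkN_insert_le (M := M) (hGg (hQG hwQ)) hle
  rw [mem_coloops] at hcol
  apply hcol.2
  rw [hset]
  exact hmem

/-- **`L1` at a level-1 target is at most the sum of the requests of the active faces whose hyperplane contains `y`.** -/
theorem L1_insert_le_sum_support (hG : G ∈ flatsQ M (5 + 1)) (hd : (gr M \ G).card = 2)
    (hk : kColoops M G = 1) {B : Finset α} (hB : B ∈ thinMembers M 5 G) (hnP : ¬ bigP M G B) {z : α}
    (hz : z ∈ G \ clF M B) {y : α} (hy : y ∈ G \ insert z B) :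
    L1 M 5 G (insert y (insert z B)) ≤ ∑ w ∈ (insert z B \ coloops M G).filter
      (fun w => faceOk M G (insert z B) w ∧ y ∈ clF M ((insert z B).erase w)), req M 5 ((insert z B).erase w) := by
  have hT : insert y (insert z B) ∈ tgtSets M 5 G B z :=
    level_one_targets_subset hG hB hz (Finset.mem_image.2 ⟨y, hy, rfl⟩)
  refine le_trans (L1_le_sum_base_req_coloops hG hd hk hB hz hT) ?_
  apply Finset.sum_le_sum_of_subset_of_nonneg
  · intro w hw
    rw [Finset.mem_filter] at hw ⊢
    exact ⟨hw.1, hw.2.1, mem_clF_erase_of_mem_coloops_insert hG hd hk hB hnP hz hy hw.1 hw.2.2⟩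
  · intro w _ _
    exact req_nonneg _ _

/-- **The capacity floor at a level-1 target**: `vCap (Q ∪ {y}) ≥ 11/18 − Σ_{w active, y ∈ cl (Q.erase w)} r_w`. -/
theorem vCap_insert_ge (hG : G ∈ flatsQ M (5 + 1)) (hd : (gr M \ G).card = 2) (hk : kColoops M G = 1)
    (hs : ∀ e ∈ gr M, ∀ f ∈ gr M, e ≠ f → rkN M {e, f} = 2) (hl : ∀ e ∈ gr M, M.Indep {e}) {B : Finset α}
    (hB : B ∈ thinMembers M 5 G) (hnP : ¬ bigP M G B) {z : α} (hz : z ∈ G \ clF M B) {y : α}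
    (hy : y ∈ G \ insert z B) :
    11 / 18 - ∑ w ∈ (insert z B \ coloops M G).filter
      (fun w => faceOk M G (insert z B) w ∧ y ∈ clF M ((insert z B).erase w)), req M 5 ((insert z B).erase w) ≤
    vCap M G (insert y (insert z B)) := by
  have hL1 := L1_insert_le_sum_support hG hd hk hB hnP hz hy
  have hsum0 : 0 ≤ ∑ w ∈ (insert z B \ coloops M G).filter
      (fun w => faceOk M G (insert z B) w ∧ y ∈ clF M ((insert z B).erase w)), req M 5 ((insert z B).erase w) :=
    Finset.sum_nonneg (fun w _ => req_nonneg _ _)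
  have hTG : insert y (insert z B) ⊆ G :=
    Finset.insert_subset (Finset.mem_sdiff.1 hy).1
      (Finset.insert_subset (Finset.mem_sdiff.1 hz).1 (subset_G_of_mem_thinMembers hB))
  have hcap := capS_ge_eleven_eighteenths_two_one hd hk hTG
  unfold vCap
  by_cases h1 : (G \ insert y (insert z B)).card ≤ 1
  · rw [if_pos h1]
    linarith
  · rw [if_neg h1, if_pos (dload_insert_eq_zero hG hd hk hs hl hB hnP z y)]
    refine le_trans ?_ (le_max_right _ _)
    linarith

/-! ## The member faces inside a level-1 target -/

/-- A basis point is off the closure of the other points of `Q` (`Q` independent). -/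
theorem notMem_clF_erase_of_mem (hG : G ∈ flatsQ M (5 + 1)) (hd : (gr M \ G).card = 2) (hk : kColoops M G = 1)
    {B : Finset α} (hB : B ∈ thinMembers M 5 G) (hnP : ¬ bigP M G B) {z : α} (hz : z ∈ G \ clF M B) {w : α}
    (hw : w ∈ insert z B) : w ∉ clF M ((insert z B).erase w) := by
  intro hcl
  have hGg : G ⊆ gr M := (mem_flatsQ.1 hG).1
  have hQG : insert z B ⊆ G := Finset.insert_subset (Finset.mem_sdiff.1 hz).1 (subset_G_of_mem_thinMembers hB)
  have hQ := rkN_insert_eq_card hG hd hk hB hnP hz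
  have h1 := rkN_insert_le_of_mem_clF ((Finset.erase_subset _ _).trans (hQG.trans hGg)) hcl
  rw [Finset.insert_erase hw] at h1
  have h2 := rkN_le_card (M := M) ((insert z B).erase w)
  rw [Finset.card_erase_of_mem hw] at h2
  have h3 := Finset.card_pos.2 ⟨w, hw⟩
  omega

/-- **The member faces inside `Q ∪ {y}` not containing `y` are faces `Q.erase w` of `Q` at active `w`.** -/
theorem facesIn_insert_not_mem_subset (hG : G ∈ flatsQ M (5 + 1)) (hd : (gr M \ G).card = 2)
    (hk : kColoops M G = 1) {B : Finset α} (hB : B ∈ thinMembers M 5 G) (hnP : ¬ bigP M G B) {z : α}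
    (hz : z ∈ G \ clF M B) (y : α) :
    (facesIn M G (insert y (insert z B))).filter (fun B' => y ∉ B') ⊆
      ((insert z B \ coloops M G).filter (fun w => faceOk M G (insert z B) w)).image
        (fun w => (insert z B).erase w) := by
  have hd' : (gr M \ G).card ≤ 5 := by omega
  have hGg : G ⊆ gr M := (mem_flatsQ.1 hG).1
  have hBG : B ⊆ G := subset_G_of_mem_thinMembers hB
  have hKB : coloops M G ⊆ B := coloops_subset_of_mem_thinMembers hG hd' hB
  have hzB : z ∉ B := fun h => (Finset.mem_sdiff.1 hz).2 (subset_clF_of_subset_gr (hBG.trans hGg) h)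
  have hQcard : (insert z B).card = 6 := by
    have h4 := card_sdiff_eq_four_of_not_bigP hG hd hk hB hnP
    have h1 := Finset.card_sdiff_add_card_eq_card hKB
    rw [← kColoops_eq_card_coloops, hk, h4] at h1
    rw [Finset.card_insert_of_notMem hzB]
    omega
  intro B' hB'
  rw [Finset.mem_filter] at hB'
  obtain ⟨hB'in, hyB'⟩ := hB'
  unfold facesIn at hB'in
  rw [Finset.mem_filter] at hB'in
  obtain ⟨hB'thin, hnP', hB'T⟩ := hB'in
  have hB'Q : B' ⊆ insert z B := by
    intro e he
    have := hB'T he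
    rw [Finset.mem_insert] at this
    rcases this with rfl | h
    · exact absurd he hyB'
    · exact h
  have hKB' : coloops M G ⊆ B' := coloops_subset_of_mem_thinMembers hG hd' hB'thin
  have hB'card : B'.card = 5 := by
    have h4 := card_sdiff_eq_four_of_not_bigP hG hd hk hB'thin hnP'
    have h1 := Finset.card_sdiff_add_card_eq_card hKB'
    rw [← kColoops_eq_card_coloops, hk, h4] at h1
    omega
  have hone : (insert z B \ B').card = 1 := by
    rw [Finset.card_sdiff_of_subset hB'Q, hQcard, hB'card]
  obtain ⟨w, hw⟩ := Finset.card_eq_one.1 hone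
  have hwQ : w ∈ insert z B := (Finset.mem_sdiff.1 (hw ▸ Finset.mem_singleton_self w)).1
  have hwB' : w ∉ B' := (Finset.mem_sdiff.1 (hw ▸ Finset.mem_singleton_self w)).2
  have hB'eq : B' = (insert z B).erase w := by
    ext e
    rw [Finset.mem_erase]
    constructor
    · intro he
      exact ⟨fun h => hwB' (h ▸ he), hB'Q he⟩
    · rintro ⟨hew, heQ⟩
      by_contra heB'
      have : e ∈ insert z B \ B' := Finset.mem_sdiff.2 ⟨heQ, heB'⟩
      rw [hw, Finset.mem_singleton] at this
      exact hew this
  rw [Finset.mem_image]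
  refine ⟨w, Finset.mem_filter.2 ⟨Finset.mem_sdiff.2 ⟨hwQ, fun h => hwB' (hKB' h)⟩, ?_⟩, hB'eq.symm⟩
  refine ⟨hB'eq ▸ hB'thin, ?_⟩
  rw [Finset.mem_sdiff]
  exact ⟨(Finset.insert_subset (Finset.mem_sdiff.1 hz).1 hBG) hwQ, notMem_clF_erase_of_mem hG hd hk hB hnP hz hwQ⟩

/-- **At most ten member faces inside `Q ∪ {y}` contain `y`**: they are determined by three points of `Q′`. -/
theorem card_facesIn_mem_le_ten (hG : G ∈ flatsQ M (5 + 1)) (hd : (gr M \ G).card = 2) (hk : kColoops M G = 1)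
    {B : Finset α} (hB : B ∈ thinMembers M 5 G) (hnP : ¬ bigP M G B) {z : α} (hz : z ∈ G \ clF M B) {y : α}
    (hy : y ∈ G \ insert z B) :
    ((facesIn M G (insert y (insert z B))).filter (fun B' => y ∈ B')).card ≤ 10 := by
  have hd' : (gr M \ G).card ≤ 5 := by omega
  have hGg : G ⊆ gr M := (mem_flatsQ.1 hG).1
  have hBG : B ⊆ G := subset_G_of_mem_thinMembers hB
  have hKB : coloops M G ⊆ B := coloops_subset_of_mem_thinMembers hG hd' hB
  have hzB : z ∉ B := fun h => (Finset.mem_sdiff.1 hz).2 (subset_clF_of_subset_gr (hBG.trans hGg) h)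
  have hyQ : y ∉ insert z B := (Finset.mem_sdiff.1 hy).2
  have hQ'card : (insert z B \ coloops M G).card = 5 := by
    have h4 := card_sdiff_eq_four_of_not_bigP hG hd hk hB hnP
    rw [insert_sdiff_coloops_eq (fun h => hzB (hKB h)), Finset.card_insert_of_notMem
      (fun h => hzB (Finset.mem_sdiff.1 h).1), h4]
  have h10 : ((insert z B \ coloops M G).powersetCard 3).card = 10 := by
    rw [Finset.card_powersetCard, hQ'card]
    decide
  rw [← h10]
  apply Finset.card_le_card_of_injOn (fun B' => (B' \ coloops M G).erase y)
  · intro B' hB'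
    rw [Finset.mem_coe, Finset.mem_filter] at hB'
    obtain ⟨hB'in, hyB'⟩ := hB'
    unfold facesIn at hB'in
    rw [Finset.mem_filter] at hB'in
    obtain ⟨hB'thin, hnP', hB'T⟩ := hB'in
    have h4 := card_sdiff_eq_four_of_not_bigP hG hd hk hB'thin hnP'
    rw [Finset.mem_coe, Finset.mem_powersetCard]
    refine ⟨?_, ?_⟩
    · intro e he
      rw [Finset.mem_erase, Finset.mem_sdiff] at he
      rw [Finset.mem_sdiff]
      have := hB'T he.2.1
      rw [Finset.mem_insert] at this
      exact ⟨this.resolve_left he.1, he.2.2⟩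
    · rw [Finset.card_erase_of_mem (Finset.mem_sdiff.2 ⟨hyB', fun h => hyQ (Finset.mem_insert_of_mem (hKB h))⟩), h4]
  · intro B₁ hB₁ B₂ hB₂ heq
    rw [Finset.mem_coe, Finset.mem_filter] at hB₁ hB₂
    have hK₁ : coloops M G ⊆ B₁ := by
      unfold facesIn at hB₁
      exact coloops_subset_of_mem_thinMembers hG hd' (Finset.mem_filter.1 hB₁.1).1
    have hK₂ : coloops M G ⊆ B₂ := by
      unfold facesIn at hB₂
      exact coloops_subset_of_mem_thinMembers hG hd' (Finset.mem_filter.1 hB₂.1).1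
    have hy₁ : y ∈ B₁ \ coloops M G := Finset.mem_sdiff.2 ⟨hB₁.2, fun h => hyQ (Finset.mem_insert_of_mem (hKB h))⟩
    have hy₂ : y ∈ B₂ \ coloops M G := Finset.mem_sdiff.2 ⟨hB₂.2, fun h => hyQ (Finset.mem_insert_of_mem (hKB h))⟩
    simp only at heq
    have h1 : B₁ \ coloops M G = B₂ \ coloops M G := by
      rw [← Finset.insert_erase hy₁, ← Finset.insert_erase hy₂, heq]
    rw [← Finset.sdiff_union_of_subset hK₁, ← Finset.sdiff_union_of_subset hK₂, h1]

/-- **The face sum at a level-1 target**: the faces of `Q` with their weights plus at most `2/9` per face through `y`. -/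
theorem faceSum_insert_le (hG : G ∈ flatsQ M (5 + 1)) (hd : (gr M \ G).card = 2) (hk : kColoops M G = 1)
    (hnf : fatClosures M 5 G 2 = ∅) {B : Finset α} (hB : B ∈ thinMembers M 5 G) (hnP : ¬ bigP M G B) {z : α}
    (hz : z ∈ G \ clF M B) {y : α} (hy : y ∈ G \ insert z B) :
    faceSum M G (insert y (insert z B)) ≤
      (∑ w ∈ (insert z B \ coloops M G).filter (fun w => faceOk M G (insert z B) w),
        phiFace M ((insert z B).erase w) *
          (((insert y (insert z B) \ coloops M G) \ clF M ((insert z B).erase w)).card : ℚ)) +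
      2 / 9 * (((facesIn M G (insert y (insert z B))).filter (fun B' => y ∈ B')).card : ℚ) := by
  have hd' : (gr M \ G).card ≤ 5 := by omega
  rw [faceSum_eq_sum_facesIn]
  rw [← Finset.sum_filter_add_sum_filter_not (facesIn M G (insert y (insert z B))) (fun B' => y ∉ B')]
  apply add_le_add
  · -- the faces of `Q`
    calc ∑ B' ∈ (facesIn M G (insert y (insert z B))).filter (fun B' => y ∉ B'),
          hypWeight M G (insert y (insert z B)) (clF M B')
        ≤ ∑ B' ∈ ((insert z B \ coloops M G).filter (fun w => faceOk M G (insert z B) w)).image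
            (fun w => (insert z B).erase w), hypWeight M G (insert y (insert z B)) (clF M B') := by
          apply Finset.sum_le_sum_of_subset_of_nonneg (facesIn_insert_not_mem_subset hG hd hk hB hnP hz y)
          intro B' _ _
          exact hypWeight_nonneg _ _
      _ = ∑ w ∈ (insert z B \ coloops M G).filter (fun w => faceOk M G (insert z B) w),
            hypWeight M G (insert y (insert z B)) (clF M ((insert z B).erase w)) := by
          apply Finset.sum_image
          intro w hw w' hw' h
          exact erase_injOn (insert z B) (Finset.mem_sdiff.1 (Finset.mem_filter.1 hw).1).1
            (Finset.mem_sdiff.1 (Finset.mem_filter.1 hw').1).1 h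
      _ = ∑ w ∈ (insert z B \ coloops M G).filter (fun w => faceOk M G (insert z B) w),
            phiFace M ((insert z B).erase w) *
              (((insert y (insert z B) \ coloops M G) \ clF M ((insert z B).erase w)).card : ℚ) := by
          apply Finset.sum_congr rfl
          intro w _
          unfold hypWeight
          rw [phiFace_eq_of_clF]
  · -- the faces through `y`
    simp only [not_not]
    calc ∑ B' ∈ (facesIn M G (insert y (insert z B))).filter (fun B' => y ∈ B'),
          hypWeight M G (insert y (insert z B)) (clF M B')
        ≤ ∑ _B' ∈ (facesIn M G (insert y (insert z B))).filter (fun B' => y ∈ B'), (2 / 9 : ℚ) := by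
          apply Finset.sum_le_sum
          intro B' hB'
          rw [Finset.mem_filter] at hB'
          have hB'in := hB'.1
          unfold facesIn at hB'in
          rw [Finset.mem_filter] at hB'in
          obtain ⟨hB'thin, hnP', hB'T⟩ := hB'in
          have hKB' : coloops M G ⊆ B' := coloops_subset_of_mem_thinMembers hG hd' hB'thin
          unfold hypWeight
          rw [← phiFace_eq_of_clF]
          have hphi := phiFace_le_of_nonfat hG hd hnf hB'thin
          have hc : (((insert y (insert z B) \ coloops M G) \ clF M B').card : ℚ) ≤ 2 := by
            have h6 := card_insert_sdiff_coloops_eq_six hG hd hk hB hnP hz hy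
            have h4 := card_sdiff_eq_four_of_not_bigP hG hd hk hB'thin hnP'
            have hsub : B' \ coloops M G ⊆ insert y (insert z B) \ coloops M G :=
              Finset.sdiff_subset_sdiff hB'T (le_refl _)
            have hsub2 : (insert y (insert z B) \ coloops M G) \ clF M B' ⊆
                (insert y (insert z B) \ coloops M G) \ (B' \ coloops M G) := by
              intro e he
              rw [Finset.mem_sdiff] at he ⊢
              refine ⟨he.1, fun h => he.2 ?_⟩
              exact subset_clF_of_subset_gr ((subset_G_of_mem_thinMembers hB'thin).trans (mem_flatsQ.1 hG).1)
                (Finset.mem_sdiff.1 h).1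
            have := Finset.card_le_card hsub2
            rw [Finset.card_sdiff_of_subset hsub, h6, h4] at this
            exact_mod_cast this
          calc phiFace M B' * (((insert y (insert z B) \ coloops M G) \ clF M B').card : ℚ) ≤ (1 / 9) * 2 :=
                mul_le_mul hphi hc (by positivity) (by norm_num)
            _ = 2 / 9 := by norm_num
      _ = 2 / 9 * (((facesIn M G (insert y (insert z B))).filter (fun B' => y ∈ B')).card : ℚ) := by
          rw [Finset.sum_const, nsmul_eq_mul, mul_comm]

/-- The weight factor of a face `Q.erase w` at `Q ∪ {y}`: `|(T ∖ K) ∖ cl (Q.erase w)| = 1 + [y ∉ cl (Q.erase w)]`. -/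
theorem card_sdiff_clF_erase_le_two (hG : G ∈ flatsQ M (5 + 1)) {B : Finset α} (hB : B ∈ thinMembers M 5 G)
    {z : α} (hz : z ∈ G \ clF M B) (y : α) {w : α} (hw : w ∈ insert z B) :
    ((insert y (insert z B) \ coloops M G) \ clF M ((insert z B).erase w)).card ≤
      1 + (if y ∈ clF M ((insert z B).erase w) then 0 else 1) := by
  have hGg : G ⊆ gr M := (mem_flatsQ.1 hG).1
  have hQG : insert z B ⊆ G := Finset.insert_subset (Finset.mem_sdiff.1 hz).1 (subset_G_of_mem_thinMembers hB)
  have hsub : (insert y (insert z B) \ coloops M G) \ clF M ((insert z B).erase w) ⊆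
      insert w (({y} : Finset α).filter (fun e => e ∉ clF M ((insert z B).erase w))) := by
    intro e he
    rw [Finset.mem_sdiff, Finset.mem_sdiff, Finset.mem_insert] at he
    rw [Finset.mem_insert, Finset.mem_filter, Finset.mem_singleton]
    rcases he.1.1 with h | h
    · exact Or.inr ⟨h, he.2⟩
    · by_cases hew : e = w
      · exact Or.inl hew
      · exfalso
        exact he.2 (subset_clF_of_subset_gr ((Finset.erase_subset _ _).trans (hQG.trans hGg))
          (Finset.mem_erase.2 ⟨hew, h⟩))
  have h1 := Finset.card_le_card hsub
  have h2 := Finset.card_insert_le w (({y} : Finset α).filter (fun e => e ∉ clF M ((insert z B).erase w)))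
  have h3 : (({y} : Finset α).filter (fun e => e ∉ clF M ((insert z B).erase w))).card =
      (if y ∈ clF M ((insert z B).erase w) then 0 else 1) := by
    by_cases hy : y ∈ clF M ((insert z B).erase w)
    · rw [if_pos hy, Finset.card_eq_zero, Finset.filter_eq_empty_iff]
      intro e he
      rw [Finset.mem_singleton] at he
      rw [he]
      exact not_not.2 hy
    · rw [if_neg hy, Finset.filter_singleton, if_pos hy, Finset.card_singleton]
  have _ : w ∈ insert z B := hw
  omega

end PercRepro.Shadow
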